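import Summits.AtomisticToContinuum.Crystallization.Theorems.HullExactificationCascadeHcpLandscapeGapGlueCore
import Summits.AtomisticToContinuum.Crystallization.Theorems.HullExactificationCascadeHcpLandscapeGapStubBoxMinimiserRigid
import Summits.AtomisticToContinuum.Crystallization.Theorems.HullExactificationCascadeHcpLandscapeGapStubShellGeometry

/-!
# Route HullExactificationCascade — crux B `HcpLandscapeGap` (stmt-AtomisticToContinuum-12087) is implied by the
# two cruxes of route HcpDefectCounting

`HcpLandscapeGap_of_hcpDefectCounting : HcpBulkFloor → HcpDefectCoercivity → HcpLandscapeGap`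
(stmt-14477 → stmt-14476 → stmt-12087): the composition core `HcpLandscapeGap_of_glue` with its two geometric
hypotheses discharged by the landed stubs `stub_boxMinimiserRigid` (rigidity of the box minimiser of
`e(hcp a h)`: it is the certified global minimiser, enclosed at `(0.97129, 0.79294) ± 10⁻⁴`) and
`stub_shellGeometry` (`Good(4,θ)` sites are `η`-good and not fcc-type).  Net statement for the planners: the
landscape-gap crux B of this route is CONDITIONAL on exactly the bulk floor and the radius-4 defect-counting
coercivity of route HcpDefectCounting; B itself only needs their restrictions to windows of `δ`-separated,
everywhere `1/20`-good, Barlow-templated configurations.  [folklore bookkeeping]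
-/

namespace Summit.AtomisticToContinuum.Crystallization.Theorems.HcpLandscapeGapBirth

/-- **Crux B from the HcpDefectCounting cruxes**: `HcpBulkFloor` (stmt-AtomisticToContinuum-14477) and
`HcpDefectCoercivity` (stmt-AtomisticToContinuum-14476) imply `HullExactificationCascade.HcpLandscapeGap`
(stmt-AtomisticToContinuum-12087). [folklore] -/
theorem HcpLandscapeGap_of_hcpDefectCounting : Summit.AtomisticToContinuum.Crystallization.Theses.HcpDefectCounting.HcpBulkFloor → Summit.AtomisticToContinuum.Crystallization.Theses.HcpDefectCounting.HcpDefectCoercivity → Summit.AtomisticToContinuum.Crystallization.Theses.HullExactificationCascade.HcpLandscapeGap :=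
  HcpLandscapeGap_of_glue stub_boxMinimiserRigid stub_shellGeometry

end Summit.AtomisticToContinuum.Crystallization.Theorems.HcpLandscapeGapBirth
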